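import Summits.QuantumFields.BalabanUV.T4Continuum.Support.NE3SmoothLiftProfile
import Summits.QuantumFields.BalabanUV.T4Continuum.Support.NE3TangentFlatPush
import Literature.MathematicalPhysics.QuantumFieldTheory.Balaban1983to89.B7Prop4Flat
import HarnessLib

/-!
# T⁴ programme, node NE3 — route Π, row Π-R («SMOOTH RIGHT INVERSE», D-ne3p1-g24-1 §6), file Π-R♭-2: THE SMOOTH LIFT OF A COARSE BOND FIELD
# and its EXACTNESS under the straight-line block average `linQ_M`

NE3 (node U1b) formalisation swarm, leaf seat `b2b-balaban-t4-ne3-formalise-leaf-01` (gen 7); design finding D-ne3leaf01g7-1 (`HOME/CLAIMS.log` l.21412).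
THE OBJECT.  For a coarse bond field `φ` on the `M`-lattice, **`smoothLift M φ (z, κ) := (liftNorm d M)⁻¹·lprof M (ρ_κ(z))·(Π_{j≠κ} fac_j(z)) • φ(blk M z, κ)`**:
the signed longitudinal profile of Π-R♭-1 (`NE3SmoothLiftProfile.lprof`) along κ, the transverse tent bump of K5a (`NE3TentBump.fac`) across, the block's
own coarse datum — amplitude `O(φ∕M)`, vanishing on EVERY face of the block (Π-R♭-4 turns this into `curlSq ≤ C·M^{d−4}‖φ‖²` WITHOUT `∇φ`).
THE THEOREM.  **`linQ_smoothLift`: `linQ M (smoothLift M φ) (M•y) κ = φ y κ`** (`M ≥ 2`, `d ≥ 1`) — the straight-line block average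
(Literature `B7Prop3Flat.linQ`, `B7Prop4Flat.linQ_eq_sum`; by `B7Prop4Flat.linQIter_eq_linQ_pow` this IS the k-fold iterate of the one-step line average
for `M = L^k`) reproduces the datum EXACTLY: the κ-lines starting in block `y` read offsets `t` of block `y` `(t+1)` times and of block `y + e_κ`
`(M−1−t)` times (`sum_sum_ite_lt` ∕ `sum_sum_ite_ge`), and the profile satisfies (E2)∕(E1) of Π-R♭-1 (`sum_near_weight_lprof`, `sum_far_weight_lprof`);
the transverse bump contributes its block sum `((M²−1)∕(6M))^{d−1}` (F♯1 pattern).  With `NE3TangentFlatPush.cpush_flatCfg` (`cpush L 1 = linQ − d∘F̂`)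
the residual of the FULL linearised average on `smoothLift φ` is an exact coarse 1-form — Π-R♭-3∕4 remove it with a curl-free pure-gauge corrector.

CONTENT ([folklore]; 0 sorry; DATA defs `tperp`, `liftNorm`, `smoothLift`): §1 definitions, `liftNorm_pos`, the line values `smoothLift_line_lt` ∕ `_ge`;
§2 the two re-indexing identities and the transverse factorisation `sum_boxVec_tperp_mul`; §3 **`linQ_smoothLift`**.

HONEST FRAMING.  Flat lattice kinematics of OUR lift; nothing about Bałaban's minimisers or his non-local `H` ([B9] Thm 3.12, TYPE only); the owner's SHAPE
`SmoothLift` is asserted for nothing; (P♮)_W, T-E_w and **NE3 are NOT proved**; spine PROVED 0∕9; finite T⁴ rung (B)+1 — NOT infinite volume, NOT mass gap,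
NOT `BetaPertH`, NOT Clay.  PLACEMENT: `Summits/QuantumFields/BalabanUV/`.  HONEST DEPENDENCY (cell page 1): continuum YM on T⁴ ⇐ BetaPertH ∧ nine spine
estimates (0/9 proved); BetaPertH ⇐ (D1) ∧ (D4) ∧ CAP+tail; G-an2-4 gates asym, D1 and NE2/3/4.
-/

set_option autoImplicit false

open scoped BigOperators Matrix.Norms.L2Operator
open Finset

namespace Summit.QuantumFields.BalabanUV.T4Continuum.NE3SmoothLiftFlat

open Literature.MathematicalPhysics.QuantumFieldTheory.Balaban1983to89
open B7Prop1Explicit B7Prop2Explicit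
open B7Prop3Flat (linQ)
open B7Prop4Flat (linQ_eq_sum)
open SmoothRefineBlocks (blk res blk_res_eq_of)
open NE3TentBump (fac wt_eq tentSum)
open NE3SmoothLiftProfile (lprof sum_far_weight_lprof sum_near_weight_lprof)

noncomputable section

variable {d : ℕ} {n : Type*}

/-! ## §1 The lift -/

/-- THE TRANSVERSE TENT BUMP across direction `κ`: `Π_{j≠κ} fac_j(z)` (vanishes on every block face transverse to `κ`). [folklore] -/
def tperp (M : ℕ) (κ : Fin d) (z : Site d) : ℝ := ∏ j ∈ Finset.univ.erase κ, fac M z j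

/-- THE NORMALISATION `(M^d)⁻¹·((M²−1)∕(6M))^{d−1}·(M−1)(M+1)(M+2)∕12` (block weight × transverse block sum × (E2)). [folklore] -/
def liftNorm (d M : ℕ) : ℝ :=
  ((M : ℝ) ^ d)⁻¹ * ((((M : ℝ)) ^ 2 - 1) / (6 * M)) ^ (d - 1) * ((((M : ℝ)) - 1) * ((M : ℝ) + 1) * ((M : ℝ) + 2) / 12)

/-- **THE SMOOTH LIFT** of a coarse bond field to the fine lattice of block side `M`. [folklore] -/
def smoothLift (M : ℕ) (φ : Site d → Fin d → Matrix n n ℂ) : Site d → Fin d → Matrix n n ℂ :=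
  fun z κ => ((liftNorm d M)⁻¹ * (lprof M (res M z κ) * tperp M κ z)) • φ (blk M z) κ

/-- `liftNorm > 0` for `M ≥ 2`, `d ≥ 1`. [folklore] -/
theorem liftNorm_pos {M : ℕ} (hM : 2 ≤ M) (d : ℕ) : 0 < liftNorm d M := by
  have hM2 : (2 : ℝ) ≤ M := by exact_mod_cast hM
  unfold liftNorm
  have h1 : (0 : ℝ) < ((M : ℝ)) ^ 2 - 1 := by nlinarith
  have h2 : (0 : ℝ) < ((M : ℝ)) - 1 := by linarith
  positivity

/-- Block coordinates ON A κ-LINE, near part: `z = M•y + boxVec r + i•e_κ` with `r_κ + i < M` lies in block `y` at offset `boxVec r + i•e_κ`. [folklore] -/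
theorem blk_res_line_lt {M : ℕ} (hM : 1 ≤ M) (y : Site d) (r : Fin d → Fin M) (i : ℕ) (κ : Fin d) (h : (r κ : ℕ) + i < M) :
    blk M ((M : ℤ) • y + boxVec M r + (i : ℤ) • e κ) = y
      ∧ res M ((M : ℤ) • y + boxVec M r + (i : ℤ) • e κ) = boxVec M r + (i : ℤ) • e κ := by
  refine blk_res_eq_of (L := M) hM (by rw [add_assoc]) (fun j => ?_) (fun j => ?_)
  · simp only [Pi.add_apply, boxVec, Pi.smul_apply, e_apply, smul_eq_mul]
    split_ifs
    · positivity
    · simp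
  · simp only [Pi.add_apply, boxVec, Pi.smul_apply, e_apply, smul_eq_mul]
    split_ifs with hj
    · subst hj; rw [mul_one]; exact_mod_cast h
    · simp only [mul_zero, add_zero, Nat.cast_lt]; exact (r j).isLt

/-- Block coordinates ON A κ-LINE, far part: with `M ≤ r_κ + i < 2M` the point lies in block `y + e_κ` at offset `boxVec r + i•e_κ − M•e_κ`. [folklore] -/
theorem blk_res_line_ge {M : ℕ} (hM : 1 ≤ M) (y : Site d) (r : Fin d → Fin M) (i : ℕ) (hi : i < M) (κ : Fin d)
    (h : M ≤ (r κ : ℕ) + i) :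
    blk M ((M : ℤ) • y + boxVec M r + (i : ℤ) • e κ) = y + e κ
      ∧ res M ((M : ℤ) • y + boxVec M r + (i : ℤ) • e κ) = boxVec M r + (i : ℤ) • e κ - (M : ℤ) • e κ := by
  refine blk_res_eq_of (L := M) hM (by rw [smul_add]; abel) (fun j => ?_) (fun j => ?_)
  · simp only [Pi.add_apply, Pi.sub_apply, boxVec, Pi.smul_apply, e_apply, smul_eq_mul]
    split_ifs with hj
    · subst hj
      have : ((M : ℕ) : ℤ) ≤ (((r j : ℕ) + i : ℕ) : ℤ) := by exact_mod_cast h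
      push_cast at this; linarith
    · simp
  · simp only [Pi.add_apply, Pi.sub_apply, boxVec, Pi.smul_apply, e_apply, smul_eq_mul]
    split_ifs with hj
    · subst hj
      have h1 : ((r j : ℕ) : ℤ) < M := by exact_mod_cast (r j).isLt
      have h2 : (i : ℤ) < M := by exact_mod_cast hi
      linarith
    · simp only [mul_zero, add_zero, sub_zero, Nat.cast_lt]; exact (r j).isLt

/-- The transverse bump on a κ-line depends on the transverse offsets only: `tperp M κ (M•y + boxVec r + i•e_κ) = Π_{j≠κ} (r_j∕M)(1 − r_j∕M)`
(`i < M`). [folklore] -/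
theorem tperp_line {M : ℕ} (hM : 1 ≤ M) (y : Site d) (r : Fin d → Fin M) {i : ℕ} (hi : i < M) (κ : Fin d) :
    tperp M κ ((M : ℤ) • y + boxVec M r + (i : ℤ) • e κ) = ∏ j ∈ Finset.univ.erase κ, ((r j : ℕ) : ℝ) / M * (1 - ((r j : ℕ) : ℝ) / M) := by
  unfold tperp
  refine Finset.prod_congr rfl fun j hj => ?_
  have hne : j ≠ κ := Finset.ne_of_mem_erase hj
  have hres : (res M ((M : ℤ) • y + boxVec M r + (i : ℤ) • e κ) j : ℝ) = ((r j : ℕ) : ℝ) := by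
    by_cases h : (r κ : ℕ) + i < M
    · rw [(blk_res_line_lt hM y r i κ h).2]; simp [boxVec, e_apply, hne]
    · rw [(blk_res_line_ge hM y r i hi κ (not_lt.mp h)).2]; simp [boxVec, e_apply, hne]
  unfold fac; rw [wt_eq, hres]

/-- THE LIFT ON A κ-LINE, near part (`r_κ + i < M`). [folklore] -/
theorem smoothLift_line_lt {M : ℕ} (hM : 1 ≤ M) (φ : Site d → Fin d → Matrix n n ℂ) (y : Site d) (r : Fin d → Fin M) {i : ℕ}
    (hi : i < M) (κ : Fin d) (h : (r κ : ℕ) + i < M) :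
    smoothLift M φ ((M : ℤ) • y + boxVec M r + (i : ℤ) • e κ) κ
      = ((liftNorm d M)⁻¹ * (lprof M (((r κ : ℕ) + i : ℕ) : ℤ)
          * ∏ j ∈ Finset.univ.erase κ, ((r j : ℕ) : ℝ) / M * (1 - ((r j : ℕ) : ℝ) / M))) • φ y κ := by
  obtain ⟨hb, hr⟩ := blk_res_line_lt hM y r i κ h
  unfold smoothLift
  rw [tperp_line hM y r hi κ, hb, hr]
  congr 3
  simp [boxVec, e_apply]

/-- THE LIFT ON A κ-LINE, far part (`M ≤ r_κ + i`, `i < M`). [folklore] -/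
theorem smoothLift_line_ge {M : ℕ} (hM : 1 ≤ M) (φ : Site d → Fin d → Matrix n n ℂ) (y : Site d) (r : Fin d → Fin M) {i : ℕ}
    (hi : i < M) (κ : Fin d) (h : M ≤ (r κ : ℕ) + i) :
    smoothLift M φ ((M : ℤ) • y + boxVec M r + (i : ℤ) • e κ) κ
      = ((liftNorm d M)⁻¹ * (lprof M (((r κ : ℕ) + i - M : ℕ) : ℤ)
          * ∏ j ∈ Finset.univ.erase κ, ((r j : ℕ) : ℝ) / M * (1 - ((r j : ℕ) : ℝ) / M))) • φ (y + e κ) κ := by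
  obtain ⟨hb, hr⟩ := blk_res_line_ge hM y r i hi κ h
  unfold smoothLift
  rw [tperp_line hM y r hi κ, hb, hr]
  congr 3
  simp only [Pi.add_apply, Pi.sub_apply, boxVec, Pi.smul_apply, e_apply, smul_eq_mul]
  push_cast [Nat.cast_sub h]
  ring

/-! ## §2 Re-indexing the line sums; the transverse factorisation -/

/-- The near fibres of `(r, i) ↦ r + i`: `Σ_{r<M} Σ_{i<M} [r + i < M]·f(r + i) = Σ_{t<M} (t + 1)·f(t)`. [folklore] -/
theorem sum_sum_ite_lt (M : ℕ) (f : ℕ → ℝ) :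
    ∑ r ∈ Finset.range M, ∑ i ∈ Finset.range M, (if r + i < M then f (r + i) else 0)
      = ∑ t ∈ Finset.range M, ((t : ℝ) + 1) * f t := by
  -- inner sum: the terms `i < M − r`, re-indexed to `t ∈ [r, M)`
  have hinner : ∀ r ∈ Finset.range M, ∑ i ∈ Finset.range M, (if r + i < M then f (r + i) else 0)
      = ∑ t ∈ Finset.range M, (if r ≤ t then f t else 0) := by
    intro r hr
    rw [Finset.mem_range] at hr
    have hsplit : Finset.range M = Finset.range (M - r) ∪ Finset.Ico (M - r) M := by
      ext x; simp only [Finset.mem_union, Finset.mem_range, Finset.mem_Ico]; omega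
    have hdisj : Disjoint (Finset.range (M - r)) (Finset.Ico (M - r) M) :=
      Finset.disjoint_left.mpr fun x h1 h2 => by rw [Finset.mem_range] at h1; rw [Finset.mem_Ico] at h2; omega
    have hA : ∑ i ∈ Finset.range (M - r), (if r + i < M then f (r + i) else 0) = ∑ i ∈ Finset.range (M - r), f (r + i) :=
      Finset.sum_congr rfl fun i hi => by rw [Finset.mem_range] at hi; rw [if_pos (by omega)]
    have hB : ∑ i ∈ Finset.Ico (M - r) M, (if r + i < M then f (r + i) else 0) = 0 :=
      Finset.sum_eq_zero fun i hi => by rw [Finset.mem_Ico] at hi; rw [if_neg (by omega)]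
    have hfil : (Finset.range M).filter (fun t => r ≤ t) = Finset.Ico r M := by
      ext t; simp only [Finset.mem_filter, Finset.mem_range, Finset.mem_Ico]; omega
    calc ∑ i ∈ Finset.range M, (if r + i < M then f (r + i) else 0)
        = ∑ i ∈ Finset.range (M - r), f (r + i) := by rw [hsplit, Finset.sum_union hdisj, hA, hB, add_zero]
      _ = ∑ t ∈ Finset.Ico r M, f t := (Finset.sum_Ico_eq_sum_range f r M).symm
      _ = ∑ t ∈ Finset.range M, (if r ≤ t then f t else 0) := by rw [← hfil, Finset.sum_filter]
  rw [Finset.sum_congr rfl hinner, Finset.sum_comm]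
  refine Finset.sum_congr rfl fun t ht => ?_
  rw [Finset.mem_range] at ht
  rw [← Finset.sum_filter, Finset.sum_const, nsmul_eq_mul]
  have : (Finset.range M).filter (fun r => r ≤ t) = Finset.range (t + 1) := by
    ext r; simp only [Finset.mem_filter, Finset.mem_range]; omega
  rw [this, Finset.card_range]; push_cast; ring

/-- The far fibres: `Σ_{r<M} Σ_{i<M} [M ≤ r + i]·f(r + i − M) = Σ_{t<M} (M − 1 − t)·f(t)`. [folklore] -/
theorem sum_sum_ite_ge (M : ℕ) (f : ℕ → ℝ) :
    ∑ r ∈ Finset.range M, ∑ i ∈ Finset.range M, (if r + i < M then 0 else f (r + i - M))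
      = ∑ t ∈ Finset.range M, (((M : ℝ)) - 1 - t) * f t := by
  have hinner : ∀ r ∈ Finset.range M, ∑ i ∈ Finset.range M, (if r + i < M then 0 else f (r + i - M))
      = ∑ t ∈ Finset.range M, (if t < r then f t else 0) := by
    intro r hr
    rw [Finset.mem_range] at hr
    have hsplit : Finset.range M = Finset.range (M - r) ∪ Finset.Ico (M - r) M := by
      ext x; simp only [Finset.mem_union, Finset.mem_range, Finset.mem_Ico]; omega
    have hdisj : Disjoint (Finset.range (M - r)) (Finset.Ico (M - r) M) :=
      Finset.disjoint_left.mpr fun x h1 h2 => by rw [Finset.mem_range] at h1; rw [Finset.mem_Ico] at h2; omega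
    have hA : ∑ i ∈ Finset.range (M - r), (if r + i < M then 0 else f (r + i - M)) = 0 :=
      Finset.sum_eq_zero fun i hi => by rw [Finset.mem_range] at hi; rw [if_pos (by omega)]
    have hB : ∑ i ∈ Finset.Ico (M - r) M, (if r + i < M then 0 else f (r + i - M))
        = ∑ i ∈ Finset.Ico (M - r) M, f (r + i - M) :=
      Finset.sum_congr rfl fun i hi => by rw [Finset.mem_Ico] at hi; rw [if_neg (by omega)]
    have hfil : (Finset.range M).filter (fun t => t < r) = Finset.range r := by
      ext t; simp only [Finset.mem_filter, Finset.mem_range]; omega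
    have hMr : M - (M - r) = r := by omega
    calc ∑ i ∈ Finset.range M, (if r + i < M then 0 else f (r + i - M))
        = ∑ i ∈ Finset.Ico (M - r) M, f (r + i - M) := by rw [hsplit, Finset.sum_union hdisj, hA, hB, zero_add]
      _ = ∑ t ∈ Finset.range r, f t := by
          rw [Finset.sum_Ico_eq_sum_range, hMr]
          exact Finset.sum_congr rfl fun i _ => by congr 1; omega
      _ = ∑ t ∈ Finset.range M, (if t < r then f t else 0) := by rw [← hfil, Finset.sum_filter]
  rw [Finset.sum_congr rfl hinner, Finset.sum_comm]
  refine Finset.sum_congr rfl fun t ht => ?_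
  rw [Finset.mem_range] at ht
  rw [← Finset.sum_filter, Finset.sum_const, nsmul_eq_mul]
  have : (Finset.range M).filter (fun r => t < r) = Finset.Ico (t + 1) M := by
    ext r; simp only [Finset.mem_filter, Finset.mem_range, Finset.mem_Ico]; omega
  rw [this, Nat.card_Ico, Nat.cast_sub (by omega)]; push_cast; ring

/-- **TRANSVERSE FACTORISATION**: `Σ_{r∈[0,M)^d} (Π_{j≠κ} fac(r_j))·g(r_κ) = (Σ_{t<M} fac(t))^{d−1}·Σ_{t<M} g(t)`. [folklore] -/
theorem sum_boxVec_tperp_mul (M : ℕ) (κ : Fin d) (g : ℕ → ℝ) :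
    ∑ r : Fin d → Fin M, (∏ j ∈ Finset.univ.erase κ, ((r j : ℕ) : ℝ) / M * (1 - ((r j : ℕ) : ℝ) / M)) * g (r κ)
      = (∑ t : Fin M, ((t : ℕ) : ℝ) / M * (1 - ((t : ℕ) : ℝ) / M)) ^ (d - 1) * ∑ t : Fin M, g t := by
  let h : Fin d → Fin M → ℝ := fun j t => if j = κ then g t else ((t : ℕ) : ℝ) / M * (1 - ((t : ℕ) : ℝ) / M)
  have hterm : ∀ r : Fin d → Fin M,
      (∏ j ∈ Finset.univ.erase κ, ((r j : ℕ) : ℝ) / M * (1 - ((r j : ℕ) : ℝ) / M)) * g (r κ) = ∏ j : Fin d, h j (r j) := by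
    intro r
    rw [← Finset.mul_prod_erase Finset.univ (fun j => h j (r j)) (Finset.mem_univ κ), mul_comm]
    congr 1
    · simp [h]
    · exact Finset.prod_congr rfl fun j hj => by simp [h, Finset.ne_of_mem_erase hj]
  rw [Finset.sum_congr rfl fun r _ => hterm r, ← Fintype.piFinset_univ,
    ← Finset.prod_univ_sum (fun _ : Fin d => (Finset.univ : Finset (Fin M))) h,
    ← Finset.mul_prod_erase _ _ (Finset.mem_univ κ), mul_comm]
  congr 1
  · rw [Finset.prod_congr rfl fun j hj => show ∑ t : Fin M, h j t = ∑ t : Fin M, ((t : ℕ) : ℝ) / M * (1 - ((t : ℕ) : ℝ) / M) from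
        Finset.sum_congr rfl fun t _ => by simp [h, Finset.ne_of_mem_erase hj],
      Finset.prod_const, Finset.card_erase_of_mem (Finset.mem_univ κ), Finset.card_univ, Fintype.card_fin]
  · simp [h]

/-! ## §3 EXACTNESS under the straight-line block average -/

/-- **THE STRAIGHT-LINE BLOCK AVERAGE REPRODUCES THE DATUM**: `linQ M (smoothLift M φ) (M•y) κ = φ y κ` (`M ≥ 2`). [folklore] -/
theorem linQ_smoothLift [Fintype n] [DecidableEq n] {M : ℕ} (hM : 2 ≤ M) (φ : Site d → Fin d → Matrix n n ℂ)
    (y : Site d) (κ : Fin d) :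
    linQ M (smoothLift M φ) ((M : ℤ) • y) κ = φ y κ := by
  have hM1 : 1 ≤ M := by omega
  have hc := liftNorm_pos hM d
  set c : ℝ := liftNorm d M with hcdef
  set P : (Fin d → Fin M) → ℝ := fun r => ∏ j ∈ Finset.univ.erase κ, ((r j : ℕ) : ℝ) / M * (1 - ((r j : ℕ) : ℝ) / M) with hP
  -- the near and far longitudinal weights of a start offset `r_κ`
  let A : ℕ → ℝ := fun ρ => ∑ i ∈ Finset.range M, (if ρ + i < M then lprof M ((ρ + i : ℕ) : ℤ) else 0)
  let B : ℕ → ℝ := fun ρ => ∑ i ∈ Finset.range M, (if ρ + i < M then 0 else lprof M ((ρ + i - M : ℕ) : ℤ))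
  -- (1) each line: `Σ_i lift(x + i e_κ) = c⁻¹·P(r)·(A(r_κ)•φ y + B(r_κ)•φ (y+e_κ))`
  have hline : ∀ r : Fin d → Fin M, ∑ i : Fin M, smoothLift M φ ((M : ℤ) • y + boxVec M r + ((i : ℕ) : ℤ) • e κ) κ
      = (c⁻¹ * P r * A (r κ)) • φ y κ + (c⁻¹ * P r * B (r κ)) • φ (y + e κ) κ := by
    intro r
    have hsum : ∀ i : Fin M, smoothLift M φ ((M : ℤ) • y + boxVec M r + ((i : ℕ) : ℤ) • e κ) κ
        = (c⁻¹ * P r * (if (r κ : ℕ) + i < M then lprof M (((r κ : ℕ) + i : ℕ) : ℤ) else 0)) • φ y κ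
          + (c⁻¹ * P r * (if (r κ : ℕ) + i < M then 0 else lprof M (((r κ : ℕ) + i - M : ℕ) : ℤ))) • φ (y + e κ) κ := by
      intro i
      by_cases h : (r κ : ℕ) + i < M
      · rw [smoothLift_line_lt hM1 φ y r i.isLt κ h, if_pos h, if_pos h, mul_zero, zero_smul, add_zero, hcdef, hP]
        congr 1; ring
      · rw [smoothLift_line_ge hM1 φ y r i.isLt κ (not_lt.mp h), if_neg h, if_neg h, mul_zero, zero_smul, zero_add, hcdef, hP]
        congr 1; ring
    rw [Finset.sum_congr rfl fun i _ => hsum i, Finset.sum_add_distrib, ← Finset.sum_smul, ← Finset.sum_smul,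
      ← Finset.mul_sum, ← Finset.mul_sum]
    simp only [A, B, Fin.sum_univ_eq_sum_range (fun i => if (r κ : ℕ) + i < M then lprof M (((r κ : ℕ) + i : ℕ) : ℤ) else 0) M,
      Fin.sum_univ_eq_sum_range (fun i => if (r κ : ℕ) + i < M then (0 : ℝ) else lprof M (((r κ : ℕ) + i - M : ℕ) : ℤ)) M]
  -- (2) the block sum factorises; (E2) on the near part, (E1) on the far part
  have hT : ∑ t : Fin M, ((t : ℕ) : ℝ) / M * (1 - ((t : ℕ) : ℝ) / M) = (((M : ℝ)) ^ 2 - 1) / (6 * M) := by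
    have h := NE3TentBump.tentSum_eq hM1 1
    unfold tentSum at h
    rwa [pow_one, pow_one] at h
  have hA : ∑ r : Fin d → Fin M, P r * A (r κ) = ((((M : ℝ)) ^ 2 - 1) / (6 * M)) ^ (d - 1) * ((((M : ℝ)) - 1) * ((M : ℝ) + 1) * ((M : ℝ) + 2) / 12) := by
    rw [hP, sum_boxVec_tperp_mul M κ A, hT, Fin.sum_univ_eq_sum_range (fun t => A t) M]
    congr 1
    simp only [A]
    rw [sum_sum_ite_lt M (fun t => lprof M (t : ℤ)), ← Fin.sum_univ_eq_sum_range (fun t => ((t : ℝ) + 1) * lprof M (t : ℤ)) M,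
      sum_near_weight_lprof M hM1]
  have hB : ∑ r : Fin d → Fin M, P r * B (r κ) = 0 := by
    rw [hP, sum_boxVec_tperp_mul M κ B, Fin.sum_univ_eq_sum_range (fun t => B t) M]
    simp only [B]
    rw [sum_sum_ite_ge M (fun t => lprof M (t : ℤ)), ← Fin.sum_univ_eq_sum_range (fun t => (((M : ℝ)) - 1 - (t : ℝ)) * lprof M (t : ℤ)) M,
      sum_far_weight_lprof M hM1, mul_zero]
  -- (3) assemble
  rw [linQ_eq_sum]
  calc ∑ r : Fin d → Fin M, (((M : ℝ) ^ d)⁻¹ : ℝ) • ∑ i : Fin M, smoothLift M φ ((M : ℤ) • y + boxVec M r + ((i : ℕ) : ℤ) • e κ) κ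
      = ∑ r : Fin d → Fin M, ((((M : ℝ) ^ d)⁻¹ * (c⁻¹ * (P r * A (r κ)))) • φ y κ
          + (((M : ℝ) ^ d)⁻¹ * (c⁻¹ * (P r * B (r κ)))) • φ (y + e κ) κ) := by
        refine Finset.sum_congr rfl fun r _ => ?_
        rw [hline r, smul_add, smul_smul, smul_smul]; congr 2 <;> ring
    _ = (((M : ℝ) ^ d)⁻¹ * (c⁻¹ * ∑ r : Fin d → Fin M, P r * A (r κ))) • φ y κ
          + (((M : ℝ) ^ d)⁻¹ * (c⁻¹ * ∑ r : Fin d → Fin M, P r * B (r κ))) • φ (y + e κ) κ := by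
        rw [Finset.sum_add_distrib, ← Finset.sum_smul, ← Finset.sum_smul, Finset.mul_sum, Finset.mul_sum, Finset.mul_sum,
          Finset.mul_sum]
    _ = φ y κ := by
        rw [hA, hB, mul_zero, mul_zero, zero_smul, add_zero]
        have : ((M : ℝ) ^ d)⁻¹ * (c⁻¹ * (((((M : ℝ)) ^ 2 - 1) / (6 * M)) ^ (d - 1)
            * ((((M : ℝ)) - 1) * ((M : ℝ) + 1) * ((M : ℝ) + 2) / 12))) = 1 := by
          have hM2 : (2 : ℝ) ≤ M := by exact_mod_cast hM
          have hMd : ((M : ℝ) ^ d) ≠ 0 := by positivity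
          have h1 : ((M : ℝ)) ^ 2 - 1 ≠ 0 := by nlinarith
          have h2 : ((M : ℝ)) - 1 ≠ 0 := by linarith
          have hX : ((((M : ℝ)) ^ 2 - 1) / (6 * M)) ^ (d - 1) ≠ 0 := pow_ne_zero _ (div_ne_zero h1 (by positivity))
          have hN : (((M : ℝ)) - 1) * ((M : ℝ) + 1) * ((M : ℝ) + 2) / 12 ≠ 0 := by positivity
          rw [hcdef, liftNorm, mul_inv, mul_inv, inv_inv]
          field_simp
        rw [this, one_smul]

end

end Summit.QuantumFields.BalabanUV.T4Continuum.NE3SmoothLiftFlat
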